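import Mathlib
import Summits.ValiantsHypothesis.ValiantsHypothesis.Theses.StableRankCancellation
import HarnessLib

/-!
# Route StableRankCancellation — set-multilinear monomials are glued assignment monomials
(helpers for item stmt-ValiantsHypothesis-10614 `SpikeLemma`)

For the tree's cut matrices `coeffMat K A B` (`Literature/.../RelativeRank.lean`):

* `exists_assignMonomial_of_weight_eq` — a monomial whose block-degree vector is the profile of
  `A` IS the assignment monomial of a (unique) assignment on `A`; with
  `exists_pair_of_weight_eq_union` the two-block-set version (`A`, `B` disjoint);
* `coeff_add_mul_of_isSetMultilinear` — for `g` set-multilinear over `A` and `h` over the disjoint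
  `B`, `coeff (e_r + e_c) (g h) = coeff e_r g · coeff e_c h` (the entrywise form of the tree's
  `coeffMat_mul`, without gluing of index types);
* `sum_support_eq_sum_pairs` — a sum over a finite set of monomials of a function vanishing off the
  set and off the glued assignment monomials equals the sum over all pairs `(r, c)`; whence
  `normSq_eq_sum_pairs`: `Σ_{m ∈ supp p} ‖p_m‖² = Σ_{r,c} ‖p_{e_r+e_c}‖²` for `p` set-multilinear
  over `A ∪ B`.

Honest framing: bookkeeping lemmas; nothing here bears on VP ≠ VNP.

## References

* N. Limaye, S. Srinivasan, S. Tavenas, *Superpolynomial lower bounds against low-depth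
  algebraic circuits*, J. ACM 2025, §2.1 (set-multilinear monomials, the matrices `M_w`).
  [cite: LimayeSrinivasanTavenas2025, §2.1]
-/

set_option linter.dupNamespace false

noncomputable section

open Finset MvPolynomial

namespace Summit.ValiantsHypothesis.ValiantsHypothesis.Theorems.StableRankCancellationSml

open Literature.Computability.AlgebraicComplexity

universe v w

variable {ι : Type v} {X : ι → Type w} [DecidableEq ι]

/-- The block degree of a monomial at the block `i` is the sum of its exponents in that block.
[folklore] -/
theorem weight_blockWeight_apply (m : (Σ i, X i) →₀ ℕ) (i : ι) :
    Finsupp.weight (blockWeight (Sigma.fst : (Σ i, X i) → ι)) m i =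
      ∑ v ∈ m.support, if v.1 = i then m v else 0 := by
  rw [weight_blockWeight_eq_mapDomain, Finsupp.mapDomain, Finsupp.sum_apply, Finsupp.sum]
  refine sum_congr rfl fun v _ => ?_
  rw [Finsupp.single_apply]

/-- **Set-multilinear monomials are assignment monomials**: if the block-degree vector of `m` is
the profile of `A`, then `m = e_r` for an assignment `r` on `A`.
[cite: LimayeSrinivasanTavenas2025, §2.1] -/
theorem exists_assignMonomial_of_weight_eq [∀ i, DecidableEq (X i)] {A : Finset ι}
    {m : (Σ i, X i) →₀ ℕ}
    (hm : Finsupp.weight (blockWeight (Sigma.fst : (Σ i, X i) → ι)) m = blockProfile A) :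
    ∃ r : Assignment X A, m = assignMonomial A r := by
  classical
  -- in each block `i ∈ A` there is a variable of exponent exactly `1`
  have hle : ∀ v : Σ i, X i, m v ≤ (blockProfile A) v.1 := fun v => by
    rw [← hm]; exact apply_le_weight_blockWeight _ m v
  have hex : ∀ i : A, ∃ x : X i, m ⟨i, x⟩ = 1 := by
    intro i
    have h1 : Finsupp.weight (blockWeight (Sigma.fst : (Σ i, X i) → ι)) m i = 1 := by
      rw [hm, blockProfile_apply, if_pos i.2]
    rw [weight_blockWeight_apply] at h1
    obtain ⟨v, hv, hne⟩ := exists_ne_zero_of_sum_ne_zero (by rw [h1]; exact one_ne_zero)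
    obtain ⟨j, x⟩ := v
    by_cases hji : j = (i : ι)
    · subst hji
      refine ⟨x, le_antisymm ?_ ?_⟩
      · have := hle ⟨_, x⟩
        rwa [blockProfile_apply, if_pos i.2] at this
      · rw [if_pos rfl] at hne
        exact Nat.one_le_iff_ne_zero.2 hne
    · exact absurd (if_neg hji) hne
  choose r hr using hex
  refine ⟨r, ?_⟩
  ext ⟨i, x⟩
  rw [assignMonomial_apply]
  by_cases hi : i ∈ A
  · rw [dif_pos hi]
    by_cases hx : r ⟨i, hi⟩ = x
    · rw [if_pos hx, ← hx]; exact hr ⟨i, hi⟩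
    · rw [if_neg hx]
      -- two variables of the same block cannot both carry a positive exponent
      by_contra hne
      have h2 : m ⟨i, r ⟨i, hi⟩⟩ + m ⟨i, x⟩ ≤
          Finsupp.weight (blockWeight (Sigma.fst : (Σ i, X i) → ι)) m i := by
        rw [weight_blockWeight_apply]
        have hmem1 : (⟨i, r ⟨i, hi⟩⟩ : Σ i, X i) ∈ m.support := by
          rw [Finsupp.mem_support_iff, hr ⟨i, hi⟩]; exact one_ne_zero
        have hmem2 : (⟨i, x⟩ : Σ i, X i) ∈ m.support := by
          rw [Finsupp.mem_support_iff]; exact hne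
        have hne' : (⟨i, r ⟨i, hi⟩⟩ : Σ i, X i) ≠ ⟨i, x⟩ := fun h => hx (by
          have := (Sigma.mk.inj_iff.1 h).2; exact eq_of_heq this)
        calc m ⟨i, r ⟨i, hi⟩⟩ + m ⟨i, x⟩
            = (if (⟨i, r ⟨i, hi⟩⟩ : Σ i, X i).1 = i then m ⟨i, r ⟨i, hi⟩⟩ else 0) +
              (if (⟨i, x⟩ : Σ i, X i).1 = i then m ⟨i, x⟩ else 0) := by simp
          _ ≤ ∑ v ∈ m.support, if v.1 = i then m v else 0 :=
              add_le_sum (f := fun v : Σ i, X i => if v.1 = i then m v else 0)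
                (fun v _ => Nat.zero_le _) hmem1 hmem2 hne'
      rw [hm, blockProfile_apply, if_pos hi, hr ⟨i, hi⟩] at h2
      omega
  · rw [dif_neg hi]
    have := hle ⟨i, x⟩
    rw [blockProfile_apply, if_neg hi] at this
    exact Nat.le_zero.1 this

/-- Two-block-set version: a monomial of block profile `A ∪ B` (`A`, `B` disjoint) is a glued
assignment monomial `e_r + e_c`. [cite: LimayeSrinivasanTavenas2025, §2.1] -/
theorem exists_pair_of_weight_eq_union {A B : Finset ι} (hAB : Disjoint A B)
    [∀ i, DecidableEq (X i)] {m : (Σ i, X i) →₀ ℕ}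
    (hm : Finsupp.weight (blockWeight (Sigma.fst : (Σ i, X i) → ι)) m = blockProfile (A ∪ B)) :
    ∃ (r : Assignment X A) (c : Assignment X B), m = assignMonomial A r + assignMonomial B c := by
  obtain ⟨rc, hrc⟩ := exists_assignMonomial_of_weight_eq hm
  refine ⟨((Equiv.piFinsetUnion X hAB).symm rc).1, ((Equiv.piFinsetUnion X hAB).symm rc).2, ?_⟩
  have := assignMonomial_piFinsetUnion hAB ((Equiv.piFinsetUnion X hAB).symm rc).1
    ((Equiv.piFinsetUnion X hAB).symm rc).2
  rw [Prod.mk.eta, Equiv.apply_symm_apply] at this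
  rw [hrc, this]

/-- **Entries of a product factor**: for `g` set-multilinear over `A` and `h` over the disjoint
`B`, `coeff (e_r + e_c) (g h) = coeff e_r g · coeff e_c h`.
[cite: LimayeSrinivasanTavenas2025, Claim 7] -/
theorem coeff_add_mul_of_isSetMultilinear {K : Type*} [Field K] {A B : Finset ι}
    (hAB : Disjoint A B) {g h : MvPolynomial (Σ i, X i) K}
    (hg : IsSetMultilinear Sigma.fst A g) (hh : IsSetMultilinear Sigma.fst B h)
    (r : Assignment X A) (c : Assignment X B) :
    coeff (assignMonomial A r + assignMonomial B c) (g * h) =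
      coeff (assignMonomial A r) g * coeff (assignMonomial B c) h := by
  classical
  rw [coeff_mul]
  have hs₁ : BlockSupportedOn Sigma.fst A (assignMonomial A r) :=
    blockSupportedOn_of_weight_eq (weight_assignMonomial A r)
  have hs₂ : BlockSupportedOn Sigma.fst B (assignMonomial B c) :=
    blockSupportedOn_of_weight_eq (weight_assignMonomial B c)
  rw [Finset.sum_eq_single (assignMonomial A r, assignMonomial B c)]
  · rintro ⟨a, b⟩ hab hne
    by_contra hprod
    have ha : coeff a g ≠ 0 := fun h0 => hprod (by rw [h0, zero_mul])
    have hb : coeff b h ≠ 0 := fun h0 => hprod (by rw [h0, mul_zero])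
    have ha' := blockSupportedOn_of_weight_eq (hg ha)
    have hb' := blockSupportedOn_of_weight_eq (hh hb)
    obtain ⟨h1, h2⟩ := BlockSupportedOn.eq_of_add_eq_add hAB ha' hb' hs₁ hs₂
      (Finset.HasAntidiagonal.mem_antidiagonal.1 hab)
    exact hne (Prod.ext h1 h2)
  · intro h
    exact (h (Finset.HasAntidiagonal.mem_antidiagonal.2 rfl)).elim

/-- **Reindexing by pairs**: a sum over a finite set `U` of monomials of a function that vanishes
outside `U` and outside the glued assignment monomials of `(A, B)` equals the sum over all pairs.
[folklore] -/
theorem sum_eq_sum_pairs [∀ i, Fintype (X i)] {M : Type*} [AddCommMonoid M] {A B : Finset ι}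
    (hAB : Disjoint A B) (F : ((Σ i, X i) →₀ ℕ) → M) (U : Finset ((Σ i, X i) →₀ ℕ))
    (hU : ∀ m ∈ U, F m ≠ 0 →
      ∃ (r : Assignment X A) (c : Assignment X B), m = assignMonomial A r + assignMonomial B c)
    (hF : ∀ (r : Assignment X A) (c : Assignment X B),
      assignMonomial A r + assignMonomial B c ∉ U → F (assignMonomial A r + assignMonomial B c) = 0) :
    ∑ m ∈ U, F m = ∑ r : Assignment X A, ∑ c : Assignment X B,
      F (assignMonomial A r + assignMonomial B c) := by
  classical
  set φ : Assignment X A × Assignment X B → (Σ i, X i) →₀ ℕ :=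
    fun rc => assignMonomial A rc.1 + assignMonomial B rc.2 with hφ
  have hinj : Function.Injective φ := by
    rintro ⟨r, c⟩ ⟨r', c'⟩ h
    obtain ⟨h1, h2⟩ := assignMonomial_add_injective hAB h
    exact Prod.ext h1 h2
  rw [← Fintype.sum_prod_type', ← sum_image (f := F) (s := univ) (g := φ) (fun x _ y _ h => hinj h)]
  -- both sides are the sum over `U ∪ image`
  have h1 : ∑ m ∈ U, F m = ∑ m ∈ U ∪ univ.image φ, F m :=
    sum_subset subset_union_left fun m hm hmU => by
      rcases mem_union.1 hm with h | h
      · exact absurd h hmU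
      · obtain ⟨⟨r, c⟩, _, rfl⟩ := mem_image.1 h
        exact hF r c hmU
  have h2 : ∑ m ∈ univ.image φ, F m = ∑ m ∈ U ∪ univ.image φ, F m :=
    sum_subset subset_union_right fun m hm hmI => by
      by_contra hne
      rcases mem_union.1 hm with h | h
      · obtain ⟨r, c, rfl⟩ := hU m h hne
        exact hmI (mem_image.2 ⟨(r, c), mem_univ _, rfl⟩)
      · exact hmI h
  rw [h1, h2]

/-- `Σ_{m ∈ supp p} ‖p_m‖² = Σ_{r,c} ‖p_{e_r + e_c}‖²` for `p` set-multilinear over `A ∪ B`.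
[cite: LimayeSrinivasanTavenas2025, §2.1] -/
theorem normSq_eq_sum_pairs [∀ i, Fintype (X i)] [∀ i, DecidableEq (X i)] {A B : Finset ι} (hAB : Disjoint A B)
    {p : MvPolynomial (Σ i, X i) ℂ} (hp : IsSetMultilinear Sigma.fst (A ∪ B) p) :
    ∑ m ∈ p.support, ‖coeff m p‖ ^ 2 = ∑ r : Assignment X A, ∑ c : Assignment X B,
      ‖coeff (assignMonomial A r + assignMonomial B c) p‖ ^ 2 := by
  refine sum_eq_sum_pairs hAB (fun m => ‖coeff m p‖ ^ 2) p.support (fun m hm _ => ?_)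
    (fun r c hrc => ?_)
  · exact exists_pair_of_weight_eq_union hAB (hp (mem_support_iff.1 hm))
  · rw [notMem_support_iff.1 hrc, norm_zero, zero_pow two_ne_zero]

/-- The mixed sum `Σ_{m ∈ supp T} conj(p_m) T_m` over pairs, for `p` set-multilinear over
`A ∪ B`. [cite: LimayeSrinivasanTavenas2025, §2.1] -/
theorem inner_eq_sum_pairs [∀ i, Fintype (X i)] [∀ i, DecidableEq (X i)] {A B : Finset ι} (hAB : Disjoint A B)
    {p : MvPolynomial (Σ i, X i) ℂ} (hp : IsSetMultilinear Sigma.fst (A ∪ B) p)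
    (T : MvPolynomial (Σ i, X i) ℂ) :
    ∑ m ∈ T.support, (starRingEnd ℂ) (coeff m p) * coeff m T =
      ∑ r : Assignment X A, ∑ c : Assignment X B,
        (starRingEnd ℂ) (coeff (assignMonomial A r + assignMonomial B c) p) *
          coeff (assignMonomial A r + assignMonomial B c) T := by
  refine sum_eq_sum_pairs hAB (fun m => (starRingEnd ℂ) (coeff m p) * coeff m T) T.support
    (fun m _ hne => ?_) (fun r c hrc => ?_)
  · have : coeff m p ≠ 0 := fun h0 => hne (by rw [h0, map_zero, zero_mul])
    exact exists_pair_of_weight_eq_union hAB (hp this)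
  · rw [notMem_support_iff.1 hrc, mul_zero]

end Summit.ValiantsHypothesis.ValiantsHypothesis.Theorems.StableRankCancellationSml

end
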